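import Mathlib
import Literature.AlgebraicGeometry.HodgeTheory.MotivatedClassesDeformationLeaves
import Literature.AlgebraicGeometry.HodgeTheory.WeilClasses
import Literature.AlgebraicGeometry.HodgeTheory.HodgeLocus
import Literature.AlgebraicGeometry.HodgeTheory.GlobalInvariantCycles
import Literature.AlgebraicGeometry.Motives.FamiliesVHS
import Literature.AlgebraicGeometry.Motives.HyperbolicWeilType
import Literature.AlgebraicGeometry.Motives.Varieties
import Literature.AlgebraicGeometry.HodgeTheory.WeilClassesIsogenyDescent
import Literature.AlgebraicGeometry.HodgeTheory.WeilClassesSixfoldsProofs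
import Literature.AlgebraicGeometry.HodgeTheory.AlgebraicClassesCupAbelianVariety
import Literature.AlgebraicGeometry.HodgeTheory.LefschetzOneOne
import Literature.AlgebraicGeometry.HodgeTheory.FermatHypersurfaceReduction
import Literature.AlgebraicGeometry.HodgeTheory.HodgeTypeExteriorProduct
import Literature.AlgebraicGeometry.HodgeTheory.HodgeTypeConjugation
import Literature.AlgebraicGeometry.Motives.AbelianVarietyCohomologyExteriorH1
import Literature.AlgebraicGeometry.Motives.HyperbolicWeilTypeProduct
import Literature.AlgebraicTopology.SingularHomology.CupProductProofs
import Literature.NumberTheory.Transcendental.DeRhamTheoremMultiplicative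
import HarnessLib

/-!
# WeilFamilyReach

Topic `Literature/AlgebraicGeometry/HodgeTheory`. Named literature fact(s) relocated by the gate from `Summits/HodgeConjecture/HodgeConjecture/Theorems/PadicSemiregularLiftHodgeAbelianVarietiesStubSpreadClosing.lean`
(accept-time relocation of `[cite]`d propositions written inline in a Summits proposal; human ruling 2026-08-15).
Sources: Deligne1982HodgeCycles, Landherr1936HermitianForms, Milne1986AbelianVarieties, MumfordFogartyKirwan1994, vanGeemen1994HodgeAV.

* `Literature.AlgebraicGeometry.HodgeTheory.weilFamilyReach_hyperbolic`
-/

namespace Literature.AlgebraicGeometry.HodgeTheory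

open CategoryTheory
open Literature.AlgebraicGeometry Literature.AlgebraicGeometry.Motives
open Literature.AlgebraicTopology.SingularHomology

/-- **Deligne's polarized Weil family through a hyperbolic abelian `2n`-fold: relative polarization
class, flat Weil sections, and reach of every hyperbolic `(A, φ)` up to `K`-isogeny** (NAMED FACT).
Let `n, d ≥ 1`, `K = ℚ(√-d)`, and let `(P, ψ₀)` be a complex abelian `2n`-fold with `ψ₀ ≫ ψ₀ = -d`,
HYPERBOLIC (`IsHyperbolicWeilType`: a `ψ₀^*`-stable rational Lagrangian `2n`-frame of `H¹`) for the
`K`-symmetrised hyperplane class `h_K = d·e^*a + ψ₀^*e^*a` of a projective embedding `e` and a non-zero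
rational `a ∈ H²(ℙᴺ(ℂ); ℂ)` (so `h_K = ±q·c₁(M)`, `M = (e^*𝒪(1))^{⊗d} ⊗ ψ₀^*e^*𝒪(1)` ample and
`K`-compatible: `E_M(ψ₀x, ψ₀y) = d·E_M(x, y)`, Rosati = conjugation on `K`; hyperbolic ⟹ the
`K`-Hermitian form `H_M` on `H₁(P, ℚ)` has Witt index `n`, signature `(n, n)`, and `(P, K)` is of
Weil type `(n, n)`, [vanGeemen1994HodgeAV, Lemma 5.2 (1)–(2), 5.4]). Let `f : 𝒳 → S` be the universal
polarized abelian scheme with `ℤ[ψ₀]`-action over the connected component `S = Γ\X⁺` through the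
moduli point `s₀` of `(P, M, ψ₀)` of the fine moduli scheme of this PEL type with neat level
(`Γ ⊂ SU(H₁(P, ℤ), H_M)` torsion free; `S` smooth, connected, quasi-projective; `f` projective:
[Deligne1982HodgeCycles, proof of Thm. 4.8, pp. 48–50]; [MumfordFogartyKirwan1994, Thm. 7.9–7.10]),
`e' : P ≅ 𝒳_{s₀}`. Then: (a) the class `H := q·c₁(𝓜)` of the universal polarization is a global
class, rational of type `(1,1)` on every fibre, with `e'^*(H|_{s₀}) = h_K`; (b) ("`Γ ⊂ SU`, so
`det_K γ = 1`", loc. cit. p. 50; [vanGeemen1994HodgeAV, 5.8–5.11]) every Weil class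
`w ∈ ⋀^{2n}_K H¹(P) ⊗ ℂ = weilClassesOf P ψ₀ n d` extends to a CONTINUOUS (= flat) section `σ` of
`R^{2n} f_* ℂ` (`FiberClass f (2n)`), `σ(s₀) = (s₀, e'^{-1*} w)`, whose values lie in the Weil planes
of the fibres (a sub-local system) and are therefore of Hodge type `(n, n)` on EVERY fibre (clause (a)
of loc. cit.: all fibres are of Weil type `(n, n)`; [Deligne1982HodgeCycles, Prop. 4.4]); (c) REACH:
for every abelian `2n`-fold `(A, φ)`, `φ ≫ φ = -d`, hyperbolic for its own `K`-symmetrised hyperplane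
class, the `K`-Hermitian spaces `(H₁(A, ℚ), H_A)` and `(H₁(P, ℚ), ±H_M)` are both hyperbolic of rank
`2n` over `K`, hence isometric ([Landherr1936HermitianForms]; [vanGeemen1994HodgeAV, 5.3–5.4]); the
isometry carries the complex structure of `A` to a `K`-linear `E_M`-positive complex structure on
`H₁(P, ℝ)`, i.e. to a point `s₁` of the SAME connected domain, so `A` is `K`-ISOGENOUS to the fibre
`𝒳_{s₁} ≅ A'` (commensurable lattices in `H₁(P, ℚ)`): an isogeny `u : A → A'` (finite flat,
[Milne1986AbelianVarieties, §8 Prop. 8.1]) with quasi-inverse `v`, `v ∘ u = [m]`, `v` intertwining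
`φ'` and `φ`; and the flat transport `σ(s₁)` of `w ≠ 0` is a NON-ZERO class of the Weil plane of
`(A', φ')`. On the tree's real carriers, in the shape of the sibling fact
`deligne1982_weilFamily_hodgeWeilSection` (same family clauses; the tensor-point clause replaced by
the reach clause, the polarization class added). The tree constructs no moduli space of abelian
varieties, no universal abelian scheme and no period map, which is why this is a NAMED FACT.
[cite: Deligne1982HodgeCycles, proof of Thm. 4.8 (pp. 47–52) with Prop. 4.4]
[cite: vanGeemen1994HodgeAV, Lemma 5.2, 5.3–5.4 and 5.8–5.11]
[cite: Landherr1936HermitianForms, Satz (classification by rank, discriminant, signatures)]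
[cite: MumfordFogartyKirwan1994, Thm. 7.9–7.10] [cite: Milne1986AbelianVarieties, §8 Prop. 8.1]
[file AlgebraicGeometry/HodgeTheory/WeilFamilyReach] -/
def weilFamilyReach_hyperbolic : Prop :=
  ∀ (n d : ℕ), 1 ≤ n → 1 ≤ d →
    ∀ (P : Literature.AlgebraicGeometry.Motives.AbelianVariety ℂ) (ψ₀ : P ⟶ P)
      (e : Literature.AlgebraicGeometry.Motives.ProjectiveEmbedding P.X)
      (a : Literature.AlgebraicGeometry.HodgeTheory.complexBetti
        (Literature.AlgebraicGeometry.Motives.projectiveSpace e.n ℂ) 2),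
      P.dim = 2 * n → CategoryTheory.CategoryStruct.comp ψ₀ ψ₀ = -(d • CategoryTheory.CategoryStruct.id P) →
      Literature.AlgebraicGeometry.HodgeTheory.IsRationalClass a → a ≠ 0 →
      Literature.AlgebraicGeometry.Motives.IsHyperbolicWeilType P ψ₀ n
        ((d : ℂ) • Literature.AlgebraicGeometry.HodgeTheory.complexBetti.map e.ι 2 a +
          Literature.AlgebraicGeometry.HodgeTheory.complexBetti.map ψ₀.hom.hom.hom 2
            (Literature.AlgebraicGeometry.HodgeTheory.complexBetti.map e.ι 2 a)) →
    ∀ w : Literature.AlgebraicGeometry.HodgeTheory.complexBetti P.X (2 * n),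
      w ∈ Literature.AlgebraicGeometry.HodgeTheory.weilClassesOf P ψ₀ n d → w ≠ 0 →
    ∀ (A : Literature.AlgebraicGeometry.Motives.AbelianVariety ℂ) (φ : A ⟶ A)
      (eA : Literature.AlgebraicGeometry.Motives.ProjectiveEmbedding A.X)
      (aA : Literature.AlgebraicGeometry.HodgeTheory.complexBetti
        (Literature.AlgebraicGeometry.Motives.projectiveSpace eA.n ℂ) 2),
      A.dim = 2 * n → CategoryTheory.CategoryStruct.comp φ φ = -(d • CategoryTheory.CategoryStruct.id A) →
      Literature.AlgebraicGeometry.HodgeTheory.IsRationalClass aA → aA ≠ 0 →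
      Literature.AlgebraicGeometry.Motives.IsHyperbolicWeilType A φ n
        ((d : ℂ) • Literature.AlgebraicGeometry.HodgeTheory.complexBetti.map eA.ι 2 aA +
          Literature.AlgebraicGeometry.HodgeTheory.complexBetti.map φ.hom.hom.hom 2
            (Literature.AlgebraicGeometry.HodgeTheory.complexBetti.map eA.ι 2 aA)) →
      ∃ (𝒳 S : Literature.AlgebraicGeometry.Motives.SchemeOver ℂ) (f : 𝒳 ⟶ S)
        (s₀ s₁ : Literature.AlgebraicGeometry.Motives.ComplexPoints S)
        (e' : P.X ≅ Literature.AlgebraicGeometry.Motives.fiberOver f s₀)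
        (A' : Literature.AlgebraicGeometry.Motives.AbelianVariety ℂ) (φ' : A' ⟶ A')
        (e₁ : A'.X ≅ Literature.AlgebraicGeometry.Motives.fiberOver f s₁)
        (σ : Literature.AlgebraicGeometry.Motives.ComplexPoints S →
          Literature.AlgebraicGeometry.HodgeTheory.FiberClass f (2 * n))
        (H : Literature.AlgebraicGeometry.HodgeTheory.complexBetti 𝒳 2),
        Literature.AlgebraicGeometry.Motives.IsSmoothProjectiveFamily f (2 * n) ∧
        (∃ (N : ℕ) (ι : 𝒳 ⟶ CategoryTheory.MonoidalCategoryStruct.tensorObj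
            (Literature.AlgebraicGeometry.Motives.projectiveSpace N ℂ) S),
          AlgebraicGeometry.IsClosedImmersion ι.left ∧
            CategoryTheory.CategoryStruct.comp ι (CategoryTheory.CartesianMonoidalCategory.snd
              (Literature.AlgebraicGeometry.Motives.projectiveSpace N ℂ) S) = f) ∧
        IrreducibleSpace S.left ∧ AlgebraicGeometry.Smooth S.hom ∧
        Literature.AlgebraicGeometry.HodgeTheory.IsQuasiProjectiveOver S ∧
        (∀ s : Literature.AlgebraicGeometry.Motives.ComplexPoints S,
          ∃ (A'' : Literature.AlgebraicGeometry.Motives.AbelianVariety ℂ) (φ'' : A'' ⟶ A''),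
            A''.dim = 2 * n ∧
              CategoryTheory.CategoryStruct.comp φ'' φ'' = -(d • CategoryTheory.CategoryStruct.id A'') ∧
              Nonempty (A''.X ≅ Literature.AlgebraicGeometry.Motives.fiberOver f s)) ∧
        (∀ s : Literature.AlgebraicGeometry.Motives.ComplexPoints S,
          Literature.AlgebraicGeometry.HodgeTheory.IsRationalClass
              (Literature.AlgebraicGeometry.HodgeTheory.complexBetti.map
                (Literature.AlgebraicGeometry.Motives.fiberι f s) 2 H) ∧
            Literature.AlgebraicGeometry.HodgeTheory.IsOfHodgeType (2 * n)
              (Literature.AlgebraicGeometry.Motives.fiberOver f s) 2 1 1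
              (Literature.AlgebraicGeometry.HodgeTheory.complexBetti.map
                (Literature.AlgebraicGeometry.Motives.fiberι f s) 2 H)) ∧
        Literature.AlgebraicGeometry.HodgeTheory.complexBetti.map e'.hom 2
            (Literature.AlgebraicGeometry.HodgeTheory.complexBetti.map
              (Literature.AlgebraicGeometry.Motives.fiberι f s₀) 2 H) =
          (d : ℂ) • Literature.AlgebraicGeometry.HodgeTheory.complexBetti.map e.ι 2 a +
            Literature.AlgebraicGeometry.HodgeTheory.complexBetti.map ψ₀.hom.hom.hom 2
              (Literature.AlgebraicGeometry.HodgeTheory.complexBetti.map e.ι 2 a) ∧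
        Continuous σ ∧ (∀ s, (σ s).pt = s) ∧
        (∀ s, Literature.AlgebraicGeometry.HodgeTheory.IsOfHodgeType (2 * n)
          (Literature.AlgebraicGeometry.Motives.fiberOver f (σ s).pt) (2 * n) n n (σ s).cls) ∧
        σ s₀ = ⟨s₀, Literature.AlgebraicGeometry.HodgeTheory.complexBetti.map e'.inv (2 * n) w⟩ ∧
        A'.dim = 2 * n ∧
        CategoryTheory.CategoryStruct.comp φ' φ' = -(d • CategoryTheory.CategoryStruct.id A') ∧
        (∃ (u : A ⟶ A') (v : A' ⟶ A) (m : ℕ), 0 < m ∧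
          CategoryTheory.CategoryStruct.comp u v = m • CategoryTheory.CategoryStruct.id A ∧
          AlgebraicGeometry.Flat u.hom.hom.hom.left ∧
          CategoryTheory.CategoryStruct.comp v φ = CategoryTheory.CategoryStruct.comp φ' v) ∧
        ∃ w₁ : Literature.AlgebraicGeometry.HodgeTheory.complexBetti
            (Literature.AlgebraicGeometry.Motives.fiberOver f s₁) (2 * n),
          σ s₁ = ⟨s₁, w₁⟩ ∧
          Literature.AlgebraicGeometry.HodgeTheory.complexBetti.map e₁.hom (2 * n) w₁ ∈
            Literature.AlgebraicGeometry.HodgeTheory.weilClassesOf A' φ' n d ∧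
          Literature.AlgebraicGeometry.HodgeTheory.complexBetti.map e₁.hom (2 * n) w₁ ≠ 0

end Literature.AlgebraicGeometry.HodgeTheory
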